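import Literature.AlgebraicGeometry.HodgeTheory.HodgeRiemannPolarizabilityProofs
import Literature.NumberTheory.Transcendental.DeRhamTheoremMultiplicative
import HarnessLib

/-!
# Hodge classes lift along finite families of rational Hodge-linear maps (Voisin 2025, Cor. 2.12 for a family) — unconditionally, on the tree's carriers

Family `hodge`, layer `Literature/AlgebraicGeometry/HodgeTheory`. PROOF FILE (everything here is
PROVED; no definition and no named fact is introduced, D-0026). Companion of
`GysinHodgeClassLiftProofs` (the named fact `Voisin2025_hodgeClass_lift_complexGysin` — Hodge
classes in a sum of images of GYSIN morphisms lift to Hodge classes — reduced there to polarised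
Hodge structures, and since DISCHARGED: `Voisin2025_hodgeClass_lift_complexGysin_holds`,
`smoothProjective_hodgeStructure_isPolarizable_holds`, file `HodgeRiemannPolarizabilityProofs`).

C. Voisin, *Hodge and generalized Hodge conjectures, coniveau and algebraic cycles*, J. Open Math.
Probl. 1 (2025), **Cor. 2.12** (p. 24): "Let `H, H′` be Hodge structures of weight `2k`, with `H′`
polarized, and let `φ : H′ → H` be a surjective morphism of Hodge structures. Then
`φ : Hdg(H′) → Hdg(H)` is surjective. Indeed, this follows from the fact that, thanks to
Proposition 2.11, `φ` has a left inverse as morphism of Hodge structures."; and its use for a map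
which is a morphism "up to a shift of bidegrees […] called a Tate twist" (§2.1, p. 23; proof of
Prop. 3.8, p. 28: "`j_* ⊗ Id = (j, Id)_*` is a morphism of polarized Hodge structures, hence we can
apply Corollary 2.12"). The Gysin file needs the maps to be Gysin morphisms only to know that they
are (i) defined over `ℚ` and (ii) of some bidegree `(e, e)`. This file proves the statement for
an ARBITRARY finite family of `ℂ`-linear maps `G j : H^{2dⱼ}(Yⱼ(ℂ); ℂ) → H^{2q}(X(ℂ); ℂ)` between the
cohomology of smooth projective varieties which (i) carry rational classes to rational classes and
(ii) carry classes of Hodge type `(a, b)` to classes of type `(a + eⱼ, b + eⱼ)`, `dⱼ + eⱼ = q` —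
e.g. the action `Γ_* = pr_{X*}(Γ ∪ pr_Y^*(–))` of an algebraic correspondence, a composite
`φ_* ∘ π^*` of a pull-back and a Gysin morphism along a span `Y ← E → X`
(`isRationalHodgeMap_complexGysin_comp_map` below), and rescalings, sums and composites of such:

* `exists_ratLinearMap_of_isRationalClass` — a `ℂ`-linear map carrying rational classes to
  rational classes is the complexification of a `ℚ`-linear map `ψ` on the rational lattices:
  `G (ι y) = ι (ψ y)`, `ι = singularCohomology.ringChange (ℚ ↪ ℂ)` (injective, Voisin I §7.1.1).
* `HodgeModel.map_baseChange_hodgeStructure_F_le_of_hodgeType` — (ii) makes `ψ` a map of bidegree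
  `(e, e)` for the Hodge FILTRATIONS of the Hodge structures `HodgeModel.hodgeStructure` of Hodge
  symmetric models (`HodgeStructureOfHodgeModel`), as `HodgeModel.map_baseChange_hodgeStructure_F_le`
  does for Gysin morphisms.
* `exists_isRationalClass_isOfHodgeType_eq_sum_of_hodgeStructures` — **Cor. 2.12 for the family,
  local form** (abstract polarised Hodge structures `HX`, `HY j` compatible with `IsOfHodgeType`,
  as in `Voisin2025_hodgeClass_lift_complexGysin.of_hodgeStructures`): a RATIONAL class `c` of type
  `(q, q)` lying in `Σⱼ im (G j)` is `Σⱼ G j (a j)` for RATIONAL classes `a j` of type `(dⱼ, dⱼ)` —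
  one class per index, because Cor. 2.12 is applied over `ℚ`
  (`HodgeStructure.mem_iSup_map_hodgeClasses_of_bidegree`) after the rational descent
  `(Σⱼ im ψⱼ) ⊗ ℂ ∩ H^{2q}(X(ℂ); ℚ) = Σⱼ im ψⱼ` (`HodgeStructure.mem_of_ofRat_mem_baseChange`).
* `exists_isRationalClass_isOfHodgeType_eq_sum` — **the same UNCONDITIONALLY**: the Hodge
  structures are those of real Hodge models (`exists_isReal_hodgeModel_holds`), all models cut out
  the same `H^{p,q}` (`hodgePQ_independent_of_hodgeModel_holds`), and they are polarisable
  (`smoothProjective_hodgeStructure_isPolarizable_holds`, Voisin I Thm. 6.32 and §7.1.2).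
* `isRationalHodgeMap_complexGysin_comp_map` — for a span `Y ←π— E —φ→ X` of smooth projective
  varieties and degrees `2d + 2 dim X = 2q + 2 dim E`, a non-zero scalar multiple of
  `φ_* ∘ π^* : H^{2d}(Y(ℂ); ℂ) → H^{2q}(X(ℂ); ℂ)` satisfies (i) and (ii) with `e = q - d`
  (`complexGysin_ringChange_eq_smul_gysinMap`, `ringChange_map`; `IsOfHodgeType.map_of_independent`,
  `isOfHodgeType_complexGysin` fed by the theorems `nonempty_hodgeModel_holds`,
  `exists_deRhamIsoFamily_holds`).

Consumer: `FermatHodgeClassesLiftToCurvePowersSumProofs` (Shioda–Katsura: Hodge classes of Fermat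
varieties lift along the correspondences from powers of the Fermat curve).

## References

* [Voisin2025] C. Voisin, Hodge and generalized Hodge conjectures, coniveau and algebraic cycles,
  J. Open Math. Probl. 1 (2025) 16–51, §2.1 (p. 23), Prop. 2.11, Cor. 2.12 (p. 24), proof of
  Prop. 3.8 (p. 28).
* [VoisinHodgeI2002] C. Voisin, Hodge Theory and Complex Algebraic Geometry I, CUP 2002, §7.1.1,
  §7.1.2, Thm. 6.32, Lemma 7.26, §7.3.2.
* [Jannsen1990MixedMotives] U. Jannsen, Mixed Motives and Algebraic K-Theory, LNM 1400, §7, 7.8.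
* [HatcherAT2002] A. Hatcher, Algebraic Topology, CUP 2002, §3.1 p. 198.
* [FultonYoungTableaux1997] W. Fulton, Young Tableaux, CUP 1997, App. B §B.1 (5).
-/

noncomputable section

open CategoryTheory AlgebraicGeometry
open scoped TensorProduct Manifold ContDiff
open Literature.AlgebraicTopology.SingularHomology

namespace Literature.AlgebraicGeometry.HodgeTheory

section HodgeTheory

open Literature.AlgebraicGeometry.Motives

variable {m n : ℕ} {Y X : Motives.SchemeOver ℂ}

/-! ### A `ℂ`-linear map carrying rational classes to rational classes is defined over `ℚ` -/

/-- **A `ℂ`-linear map `G : Hᵃ(Y(ℂ); ℂ) → Hᵇ(X(ℂ); ℂ)` carrying rational classes to rational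
classes is the complexification of a `ℚ`-linear map on the rational lattices**: there is a
`ℚ`-linear `ψ : Hᵃ(Y(ℂ); ℚ) → Hᵇ(X(ℂ); ℚ)` with `G (ι y) = ι (ψ y)`, where
`ι = singularCohomology.ringChange (ℚ ↪ ℂ)` — `ψ y` is the unique rational preimage of the
rational class `G (ι y)` (`IsRationalClass.exists_ringChange_eq`, `ringChange_rat_injective`), and
`ψ` is additive and `ℚ`-homogeneous because `ι` is (`ringChange_ratCast_smul`).
[cite: VoisinHodgeI2002, §7.1.1] [cite: HatcherAT2002, §3.1 p. 198] -/
theorem exists_ratLinearMap_of_isRationalClass {a b : ℕ}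
    (G : complexBetti Y a →ₗ[ℂ] complexBetti X b)
    (hG : ∀ y, IsRationalClass y → IsRationalClass (G y)) :
    ∃ ψ : singularCohomology ℚ ℚ (ComplexPoints Y) a →ₗ[ℚ] singularCohomology ℚ ℚ (ComplexPoints X) b,
      ∀ y, G (singularCohomology.ringChange (algebraMap ℚ ℂ) (ComplexPoints Y) a y) =
        singularCohomology.ringChange (algebraMap ℚ ℂ) (ComplexPoints X) b (ψ y) := by
  have key : ∀ y : singularCohomology ℚ ℚ (ComplexPoints Y) a,
      ∃ x : singularCohomology ℚ ℚ (ComplexPoints X) b,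
        singularCohomology.ringChange (algebraMap ℚ ℂ) (ComplexPoints X) b x =
          G (singularCohomology.ringChange (algebraMap ℚ ℂ) (ComplexPoints Y) a y) :=
    fun y ↦ (hG _ (isRationalClass_ringChange y)).exists_ringChange_eq
  choose f hf using key
  refine ⟨{ toFun := f, map_add' := fun y y' ↦ ?_, map_smul' := fun r y ↦ ?_ }, fun y ↦ (hf y).symm⟩
  · apply ringChange_rat_injective
    rw [map_add, hf, hf, hf, map_add, map_add]
  · apply ringChange_rat_injective
    rw [RingHom.id_apply, ringChange_ratCast_smul, hf, hf, ringChange_ratCast_smul, map_smul]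

/-! ### Bidegree `(e, e)` on Hodge types gives bidegree `(e, e)` on the Hodge filtrations -/

/-- **A rational map of bidegree `(e, e)` on Hodge TYPES has bidegree `(e, e)` for the Hodge
FILTRATIONS** of the Hodge structures of Hodge models (Voisin 2025, §2.1: "up to a shift of
bidegrees […] called a Tate twist"). Let `Y`, `X` be smooth projective of dimensions `m`, `n` with
Hodge symmetric Hodge models `B`, `A`, `G : Hᵃ(Y(ℂ); ℂ) → Hᵇ(X(ℂ); ℂ)` a `ℂ`-linear map carrying
classes of type `(p, q)`, `p + q = a`, to classes of type `(p + e, q + e)`, and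
`ψ : Hᵃ(Y(ℂ); ℚ) → Hᵇ(X(ℂ); ℚ)` with `G (ι y) = ι (ψ y)`. Then `(ψ ⊗ ℂ)(Fʳ) ⊆ F^{r + e}` for the
filtrations `Fʳ = Θ⁻¹(⨁_{p ≥ r} H^{p,a-p})` of `B.hodgeStructure`, `A.hodgeStructure`: on a piece
`Θ_B⁻¹(H^{p,q})`, `p ≥ r`, `G` lands in `Θ_A⁻¹(H^{p+e,q+e}) ⊆ F^{r+e}` (`G ∘ β_Y = β_X ∘ (ψ ⊗ ℂ)`
on the complexifications, `apply_ofRatClassBaseChange_eq_smul`). Same proof as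
`HodgeModel.map_baseChange_hodgeStructure_F_le` (the Gysin case). [cite: Voisin2025, §2.1 (p. 23)]
[cite: VoisinHodgeI2002, §7.1.1 Def. 7.4 and §7.3.2] -/
theorem HodgeModel.map_baseChange_hodgeStructure_F_le_of_hodgeType
    (hI : hodgePQ_independent_of_hodgeModel) (hY : IsSmoothProjective m Y)
    (hX : IsSmoothProjective n X) (B : HodgeModel m Y) (A : HodgeModel n X)
    (hB : B.IsHodgeSymmetric) (hA : A.IsHodgeSymmetric) {a b : ℕ} (e : ℕ) (hab : a + 2 * e = b)
    (G : complexBetti Y a →ₗ[ℂ] complexBetti X b)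
    (hGtyp : ∀ ⦃p q : ℕ⦄ ⦃y : complexBetti Y a⦄, p + q = a → IsOfHodgeType m Y a p q y →
      IsOfHodgeType n X b (p + e) (q + e) (G y))
    (ψ : singularCohomology ℚ ℚ (ComplexPoints Y) a →ₗ[ℚ] singularCohomology ℚ ℚ (ComplexPoints X) b)
    (hψ : ∀ y, G (singularCohomology.ringChange (algebraMap ℚ ℂ) (ComplexPoints Y) a y) =
      singularCohomology.ringChange (algebraMap ℚ ℂ) (ComplexPoints X) b (ψ y)) (r : ℤ) :
    ((B.hodgeStructure hY hB a).F r).map (ψ.baseChange ℂ) ≤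
      (A.hodgeStructure hX hA b).F (r + (e : ℤ)) := by
  rintro _ ⟨t, ht, rfl⟩
  rw [SetLike.mem_coe, HodgeModel.hodgeStructure_F, HodgeModel.ratF_eq_iSup] at ht
  rw [HodgeModel.hodgeStructure_F, HodgeModel.ratF_eq_iSup]
  induction ht using Submodule.iSup_induction' with
  | mem pq t ht =>
    by_cases hr : r ≤ (pq.1.1 : ℤ)
    · rw [iSup_pos hr, HodgeModel.mem_ratPiece_iff, HodgeModel.complexification_apply] at ht
      have hpq : pq.1.1 + pq.1.2 = a := Finset.HasAntidiagonal.mem_antidiagonal.1 pq.2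
      -- `G (β t) = β ((ψ ⊗ ℂ) t)`
      have key := apply_ofRatClassBaseChange_eq_smul G ψ 1
        (fun y ↦ by rw [one_smul]; exact hψ y) t
      rw [one_smul] at key
      have htyp : IsOfHodgeType n X b (pq.1.1 + e) (pq.1.2 + e)
          (G (ofRatClassBaseChange (ComplexPoints Y) a t)) := hGtyp hpq ⟨B, ht⟩
      rw [key, hI.isOfHodgeType_iff hX A] at htyp
      have hanti : (pq.1.1 + e, pq.1.2 + e) ∈ Finset.HasAntidiagonal.antidiagonal b :=
        Finset.HasAntidiagonal.mem_antidiagonal.2 (by omega)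
      refine Submodule.mem_iSup_of_mem ⟨(pq.1.1 + e, pq.1.2 + e), hanti⟩
        (Submodule.mem_iSup_of_mem ?_ ?_)
      · change r + (e : ℤ) ≤ ((pq.1.1 + e : ℕ) : ℤ)
        push_cast
        omega
      · rw [HodgeModel.mem_ratPiece_iff, HodgeModel.complexification_apply]
        exact htyp
    · rw [iSup_neg hr, Submodule.mem_bot] at ht
      rw [ht, map_zero]
      exact Submodule.zero_mem _
  | zero => rw [map_zero]; exact Submodule.zero_mem _
  | add x y _ _ hx hy => rw [map_add]; exact Submodule.add_mem _ hx hy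

/-! ### Cor. 2.12 for a finite family of rational Hodge-linear maps: local form -/

/-- **Voisin 2025, Cor. 2.12 for a finite family of rational Hodge-linear maps, on the tree's
carriers — local form.** Let `X` be smooth projective of dimension `n`, `Y j` (`j ∈ ι` finite)
smooth projective of dimensions `m j`, `q, d j : ℕ`, and
`G j : H^{2dⱼ}(Y j(ℂ); ℂ) → H^{2q}(X(ℂ); ℂ)` `ℂ`-linear maps. Suppose given: a Hodge structure `HX` of
weight `2q` on `H^{2q}(X(ℂ); ℚ)` whose Hodge classes contain the rational classes of type `(q, q)`
(`hHX`); polarisable Hodge structures `HY j` of weight `2dⱼ` on `H^{2dⱼ}(Y j(ℂ); ℚ)` whose Hodge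
classes are of type `(dⱼ, dⱼ)` (`hpol`, `hHY`; "`H′ polarized`"); integers `e j` with
`2dⱼ + 2eⱼ = 2q`; and `ℚ`-linear `ψ j : H^{2dⱼ}(Y j(ℂ); ℚ) → H^{2q}(X(ℂ); ℚ)` of bidegree `(eⱼ, eⱼ)`
for the Hodge filtrations with `G j (ι y) = ι (ψ j y)` (`G j` is DEFINED OVER `ℚ`). THEN every
rational class `c ∈ H^{2q}(X(ℂ); ℂ)` of type `(q, q)` lying in `Σⱼ im (G j)` is `Σⱼ G j (a j)` for
RATIONAL classes `a j ∈ H^{2dⱼ}(Y j(ℂ); ℂ)` of type `(dⱼ, dⱼ)`. Proof: `c = ι x`, `x` a Hodge class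
of `HX`; `x ⊗ 1 ∈ Σⱼ im (ψ j)_ℂ` (`range_le_map_liftBaseChange_range`, the complexification of
`ι_X` being injective, `injective_liftBaseChange_ringChange`, and that of `ι_{Y j}` onto,
`range_liftBaseChange_ringChange_eq_top`); hence `x ∈ Σⱼ im ψ j`
(`HodgeStructure.mem_of_ofRat_mem_baseChange`: `(I ⊗ ℂ) ∩ V = I`); Cor. 2.12 for the family of
morphisms `ψ j : HY j(−eⱼ) → HX` from Tate twists of polarised structures
(`HodgeStructure.mem_iSup_map_hodgeClasses_of_bidegree`) writes `x = Σⱼ ψ j (h j)` with `h j`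
Hodge classes; `a j = ι (h j)`. [cite: Voisin2025, Cor. 2.12, Prop. 2.11, §2.1 and proof of Prop. 3.8]
[cite: VoisinHodgeI2002, §7.1.1, Lemma 7.26 and §7.3.2] [cite: Jannsen1990MixedMotives, §7, 7.8] -/
theorem exists_isRationalClass_isOfHodgeType_eq_sum_of_hodgeStructures
    {ι : Type} [Fintype ι] {m d : ι → ℕ}
    {Y : ι → Motives.SchemeOver ℂ} (hY : ∀ j, IsSmoothProjective (m j) (Y j)) (q : ℕ)
    (G : ∀ j, complexBetti (Y j) (2 * d j) →ₗ[ℂ] complexBetti X (2 * q))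
    (HX : HodgeStructure (singularCohomology ℚ ℚ (ComplexPoints X) (2 * q)) ((2 * q : ℕ) : ℤ))
    (HY : ∀ j, HodgeStructure (singularCohomology ℚ ℚ (ComplexPoints (Y j)) (2 * d j))
      ((2 * d j : ℕ) : ℤ))
    (hpol : ∀ j, (HY j).IsPolarizable)
    (hHX : ∀ x : singularCohomology ℚ ℚ (ComplexPoints X) (2 * q),
      IsOfHodgeType n X (2 * q) q q
          (singularCohomology.ringChange (algebraMap ℚ ℂ) (ComplexPoints X) (2 * q) x) →
        x ∈ HX.hodgeClasses q)
    (hHY : ∀ j (y : singularCohomology ℚ ℚ (ComplexPoints (Y j)) (2 * d j)),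
      y ∈ (HY j).hodgeClasses (d j) →
        IsOfHodgeType (m j) (Y j) (2 * d j) (d j) (d j)
          (singularCohomology.ringChange (algebraMap ℚ ℂ) (ComplexPoints (Y j)) (2 * d j) y))
    (e : ι → ℤ) (he : ∀ j, (2 * d j : ℤ) + 2 * e j = 2 * q)
    (ψ : ∀ j, singularCohomology ℚ ℚ (ComplexPoints (Y j)) (2 * d j) →ₗ[ℚ]
      singularCohomology ℚ ℚ (ComplexPoints X) (2 * q))
    (hψF : ∀ j (p : ℤ), ((HY j).F p).map ((ψ j).baseChange ℂ) ≤ HX.F (p + e j))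
    (hψG : ∀ j y, G j (singularCohomology.ringChange (algebraMap ℚ ℂ) (ComplexPoints (Y j))
        (2 * d j) y) =
      singularCohomology.ringChange (algebraMap ℚ ℂ) (ComplexPoints X) (2 * q) (ψ j y))
    {c : complexBetti X (2 * q)} (hc : IsRationalClass c) (hc' : IsOfHodgeType n X (2 * q) q q c)
    (hcg : c ∈ ⨆ j, LinearMap.range (G j)) :
    ∃ a : ∀ j, complexBetti (Y j) (2 * d j),
      (∀ j, IsRationalClass (a j) ∧ IsOfHodgeType (m j) (Y j) (2 * d j) (d j) (d j) (a j)) ∧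
        c = ∑ j, G j (a j) := by
  classical
  -- rational structures on the complex carriers (`q • x := (q : ℂ) • x`)
  letI mX : Module ℚ (complexBetti X (2 * q)) := Module.compHom _ (algebraMap ℚ ℂ)
  haveI tX : IsScalarTower ℚ ℂ (complexBetti X (2 * q)) := ⟨fun a b x ↦ by
    change (a • b) • x = algebraMap ℚ ℂ a • (b • x)
    rw [Algebra.smul_def, mul_smul]⟩
  letI mY : ∀ j k, Module ℚ (complexBetti (Y j) k) := fun j k ↦ Module.compHom _ (algebraMap ℚ ℂ)
  haveI tY : ∀ j k, IsScalarTower ℚ ℂ (complexBetti (Y j) k) := fun j k ↦ ⟨fun a b x ↦ by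
    change (a • b) • x = algebraMap ℚ ℂ a • (b • x)
    rw [Algebra.smul_def, mul_smul]⟩
  haveI hfinY : ∀ j, Module.Finite ℚ (singularCohomology ℚ ℚ (ComplexPoints (Y j)) (2 * d j)) :=
    fun j ↦ finite_singularCohomology_rat_complexPoints (hY j) _
  -- `c = ι x` with `x` a Hodge class of `HX`
  obtain ⟨x, rfl⟩ := hc.exists_ringChange_eq
  have hx : x ∈ HX.hodgeClasses q := hHX x hc'
  have hinjX : Function.Injective ((singularCohomology.ringChange (algebraMap ℚ ℂ)
      (ComplexPoints X) (2 * q)).toRatLinearMap.liftBaseChange ℂ) :=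
    injective_liftBaseChange_ringChange (ComplexPoints X) (2 * q)
  have hcx : (singularCohomology.ringChange (algebraMap ℚ ℂ) (ComplexPoints X)
      (2 * q)).toRatLinearMap.liftBaseChange ℂ (HodgeStructure.ofRat x) =
      singularCohomology.ringChange (algebraMap ℚ ℂ) (ComplexPoints X) (2 * q) x :=
    liftBaseChange_ofRat _ x
  -- `x ⊗ 1 ∈ Σⱼ im (ψ j)_ℂ`
  have h5 : HodgeStructure.ofRat x ∈ ⨆ j, LinearMap.range ((ψ j).baseChange ℂ) := by
    have hle : (⨆ j, LinearMap.range (G j)) ≤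
        (⨆ j, LinearMap.range ((ψ j).baseChange ℂ)).map
          ((singularCohomology.ringChange (algebraMap ℚ ℂ) (ComplexPoints X)
            (2 * q)).toRatLinearMap.liftBaseChange ℂ) := by
      refine iSup_le fun j ↦ ?_
      refine (range_le_map_liftBaseChange_range
        (singularCohomology.ringChange (algebraMap ℚ ℂ) (ComplexPoints X) (2 * q)).toRatLinearMap
        (singularCohomology.ringChange (algebraMap ℚ ℂ) (ComplexPoints (Y j))
          (2 * d j)).toRatLinearMap
        (G j) (ψ j) 1 (fun y ↦ by rw [one_smul]; exact hψG j y)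
        (range_liftBaseChange_ringChange_eq_top (hY j) (2 * d j))).trans (Submodule.map_mono ?_)
      exact le_iSup (fun j ↦ LinearMap.range ((ψ j).baseChange ℂ)) j
    obtain ⟨t, ht, hteq⟩ := hle hcg
    rw [← hcx] at hteq
    rw [← hinjX hteq]
    exact ht
  -- rational descent: `x ∈ Σⱼ im ψ j`
  have h6 : x ∈ ⨆ j, LinearMap.range (ψ j) := by
    refine HodgeStructure.mem_of_ofRat_mem_baseChange _ (SetLike.le_def.1 (iSup_le fun j ↦ ?_) h5)
    rw [HodgeStructure.range_baseChange]
    exact Submodule.baseChange_mono _ (le_iSup (fun j ↦ LinearMap.range (ψ j)) j)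
  -- Cor. 2.12 for the family `ψ` (Tate twists of the polarised `HY j`)
  have h7 := HodgeStructure.mem_iSup_map_hodgeClasses_of_bidegree (H' := HY) (H := HX) hpol e
    (fun j ↦ by have := he j; push_cast; omega) ψ hψF (k := (q : ℤ)) (by push_cast; ring) hx h6
  -- one Hodge class per index
  obtain ⟨f, hf, hfx⟩ := (Submodule.mem_iSup_iff_exists_finsupp _ x).1 h7
  rw [Finsupp.sum_fintype _ _ (fun _ ↦ rfl)] at hfx
  have hf' : ∀ j, ∃ h, h ∈ (HY j).hodgeClasses ((q : ℤ) - e j) ∧ ψ j h = f j :=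
    fun j ↦ Submodule.mem_map.1 (hf j)
  choose h hh hψh using hf'
  refine ⟨fun j ↦ singularCohomology.ringChange (algebraMap ℚ ℂ) (ComplexPoints (Y j)) (2 * d j) (h j),
    fun j ↦ ⟨isRationalClass_ringChange _, ?_⟩, ?_⟩
  · have e' : (q : ℤ) - e j = ((d j : ℕ) : ℤ) := by have := he j; omega
    refine hHY j (h j) ?_
    rw [← e']
    exact hh j
  · calc singularCohomology.ringChange (algebraMap ℚ ℂ) (ComplexPoints X) (2 * q) x
        = singularCohomology.ringChange (algebraMap ℚ ℂ) (ComplexPoints X) (2 * q) (∑ j, f j) := by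
          rw [hfx]
      _ = ∑ j, singularCohomology.ringChange (algebraMap ℚ ℂ) (ComplexPoints X) (2 * q) (f j) :=
          map_sum _ _ _
      _ = ∑ j, G j (singularCohomology.ringChange (algebraMap ℚ ℂ) (ComplexPoints (Y j)) (2 * d j)
            (h j)) := Finset.sum_congr rfl fun j _ ↦ by rw [hψG, hψh]

/-! ### Cor. 2.12 for a finite family of rational Hodge-linear maps: unconditionally -/

/-- **Hodge classes lift along a finite family of rational Hodge-linear maps** (Voisin 2025,
Cor. 2.12 applied, as in the proof of Prop. 3.8, to `Σⱼ G j : ⊕ⱼ H^{2dⱼ}(Y j)(−eⱼ) → H^{2q}(X)`),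
UNCONDITIONALLY on the tree's carriers. Let `X` be smooth projective of dimension `n`, `Y j`
(`j ∈ ι` finite) smooth projective of dimensions `m j`, `dⱼ + eⱼ = q`, and
`G j : H^{2dⱼ}(Y j(ℂ); ℂ) → H^{2q}(X(ℂ); ℂ)` `ℂ`-linear maps which (i) carry rational classes to
rational classes and (ii) carry classes of Hodge type `(a, b)`, `a + b = 2dⱼ`, to classes of type
`(a + eⱼ, b + eⱼ)`. Then every RATIONAL class `c ∈ H^{2q}(X(ℂ); ℂ)` of type `(q, q)` lying in
`Σⱼ im (G j)` is `Σⱼ G j (a j)` for RATIONAL classes `a j` of type `(dⱼ, dⱼ)`. The Hodge structures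
are those of real Hodge models (`exists_isReal_hodgeModel_holds`; Hodge classes = rational
classes of type `(p, p)`, `HodgeModel.mem_hodgeClasses_iff_isOfHodgeType_ringChange` through
`hodgePQ_independent_of_hodgeModel_holds`), polarised by
`smoothProjective_hodgeStructure_isPolarizable_holds` (Voisin I, Thm. 6.32, §7.1.2); (i) gives
`ψ j` (`exists_ratLinearMap_of_isRationalClass`) and (ii) its bidegree
(`HodgeModel.map_baseChange_hodgeStructure_F_le_of_hodgeType`).
[cite: Voisin2025, Cor. 2.12, Prop. 2.11, §2.1 and proof of Prop. 3.8]
[cite: VoisinHodgeI2002, Thm. 6.32, §7.1.1, §7.1.2, Lemma 7.26 and §7.3.2] -/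
theorem exists_isRationalClass_isOfHodgeType_eq_sum
    (hX : IsSmoothProjective n X) {ι : Type} [Fintype ι] {m d : ι → ℕ}
    {Y : ι → Motives.SchemeOver ℂ} (hY : ∀ j, IsSmoothProjective (m j) (Y j)) (q : ℕ)
    (e : ι → ℕ) (he : ∀ j, d j + e j = q)
    (G : ∀ j, complexBetti (Y j) (2 * d j) →ₗ[ℂ] complexBetti X (2 * q))
    (hGrat : ∀ j y, IsRationalClass y → IsRationalClass (G j y))
    (hGtyp : ∀ j ⦃a b : ℕ⦄ ⦃y : complexBetti (Y j) (2 * d j)⦄, a + b = 2 * d j →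
      IsOfHodgeType (m j) (Y j) (2 * d j) a b y →
        IsOfHodgeType n X (2 * q) (a + e j) (b + e j) (G j y))
    {c : complexBetti X (2 * q)} (hc : IsRationalClass c) (hc' : IsOfHodgeType n X (2 * q) q q c)
    (hcg : c ∈ ⨆ j, LinearMap.range (G j)) :
    ∃ a : ∀ j, complexBetti (Y j) (2 * d j),
      (∀ j, IsRationalClass (a j) ∧ IsOfHodgeType (m j) (Y j) (2 * d j) (d j) (d j) (a j)) ∧
        c = ∑ j, G j (a j) := by
  have hI : hodgePQ_independent_of_hodgeModel := hodgePQ_independent_of_hodgeModel_holds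
  -- real, hence Hodge symmetric, Hodge models
  obtain ⟨A, hA⟩ := exists_isReal_hodgeModel_holds n X hX
  have hB' : ∀ j, ∃ B : HodgeModel (m j) (Y j), B.IsReal :=
    fun j ↦ exists_isReal_hodgeModel_holds (m j) (Y j) (hY j)
  choose B hB using hB'
  -- the maps are defined over `ℚ`
  have hψ' : ∀ j, ∃ ψ : singularCohomology ℚ ℚ (ComplexPoints (Y j)) (2 * d j) →ₗ[ℚ]
      singularCohomology ℚ ℚ (ComplexPoints X) (2 * q),
      ∀ y, G j (singularCohomology.ringChange (algebraMap ℚ ℂ) (ComplexPoints (Y j)) (2 * d j) y) =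
        singularCohomology.ringChange (algebraMap ℚ ℂ) (ComplexPoints X) (2 * q) (ψ y) :=
    fun j ↦ exists_ratLinearMap_of_isRationalClass (G j) (hGrat j)
  choose ψ hψ using hψ'
  refine exists_isRationalClass_isOfHodgeType_eq_sum_of_hodgeStructures hY q G
    (A.hodgeStructure hX hA.isHodgeSymmetric (2 * q))
    (fun j ↦ (B j).hodgeStructure (hY j) (hB j).isHodgeSymmetric (2 * d j))
    (fun j ↦ smoothProjective_hodgeStructure_isPolarizable_holds (hY j) (B j)
      (hB j).isHodgeSymmetric (2 * d j))
    (fun x hx ↦ (A.mem_hodgeClasses_iff_isOfHodgeType_ringChange hX hI hA.isHodgeSymmetric q x).2 hx)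
    (fun j y hy ↦ ((B j).mem_hodgeClasses_iff_isOfHodgeType_ringChange (hY j) hI
      (hB j).isHodgeSymmetric (d j) y).1 hy)
    (fun j ↦ (e j : ℤ)) (fun j ↦ by have := he j; omega) ψ (fun j p ↦ ?_) hψ hc hc' hcg
  exact (B j).map_baseChange_hodgeStructure_F_le_of_hodgeType hI (hY j) hX A (hB j).isHodgeSymmetric
    hA.isHodgeSymmetric (e j) (by have := he j; omega) (G j) (hGtyp j) (ψ j) (hψ j) p

/-! ### Span composites `φ_* ∘ π^*` are rational Hodge-linear maps -/

/-- **The composite `φ_* ∘ π^*` of a span `Y ←π— E —φ→ X` of smooth projective varieties is, up to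
a non-zero scalar, a rational Hodge-linear map**: for `E`, `Y`, `X` smooth projective of dimensions
`k`, `m`, `n`, an orientation family `μ` with Poincaré duality, and degrees
`2d + 2n = 2q + 2k` (so that `φ_* : H^{2d}(E(ℂ); ℂ) → H^{2q}(X(ℂ); ℂ)`), `d + e = q`, there is
`u ≠ 0` such that `u • φ_*(π^* y)` is rational for `y` rational (`π^*` commutes with `ι`,
`ringChange_map`; `φ_* (ι z) = u⁻¹… • ι (f_! z)` for rational orientations,
`complexGysin_ringChange_eq_smul_gysinMap`, `exists_ratOrientation_hasPoincareDuality`), and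
`φ_*(π^* y)` is of type `(a + e, b + e)` for `y` of type `(a, b)` (`π^*` preserves Hodge types,
`IsOfHodgeType.map_of_independent`; `φ_*` shifts them by `(n - k, n - k) = (e, e)`,
`isOfHodgeType_complexGysin` with the theorems `hodgePQ_independent_of_hodgeModel_holds`,
`nonempty_hodgeModel_holds`, `exists_deRhamIsoFamily_holds`). (Voisin I §7.3.2: pull-backs and
Gysin morphisms are morphisms of Hodge structures, the latter of bidegree `(r, r)`, both defined on
`H*(–, ℤ)`.) [cite: VoisinHodgeI2002, §7.3.2] [cite: FultonYoungTableaux1997, Appendix B §B.1 (1), (5)] -/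
theorem isRationalHodgeMap_complexGysin_comp_map (μ : OrientationFamily) (hμ : μ.HasPoincareDuality)
    {k : ℕ} {E : Motives.SchemeOver ℂ} (hE : IsSmoothProjective k E) (hY : IsSmoothProjective m Y)
    (hX : IsSmoothProjective n X) (π : E ⟶ Y) (φ : E ⟶ X) {d q e : ℕ}
    (hdq : 2 * d + 2 * n = 2 * q + 2 * k) (he : d + e = q) :
    ∃ u : ℂ, u ≠ 0 ∧
      (∀ y : complexBetti Y (2 * d), IsRationalClass y →
        IsRationalClass (u • complexGysin μ hE hX φ hdq (complexBetti.map π (2 * d) y))) ∧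
      ∀ ⦃a b : ℕ⦄ ⦃y : complexBetti Y (2 * d)⦄, a + b = 2 * d → IsOfHodgeType m Y (2 * d) a b y →
        IsOfHodgeType n X (2 * q) (a + e) (b + e)
          (complexGysin μ hE hX φ hdq (complexBetti.map π (2 * d) y)) := by
  have hI : hodgePQ_independent_of_hodgeModel := hodgePQ_independent_of_hodgeModel_holds
  have htyp : ∀ ⦃a b : ℕ⦄ ⦃y : complexBetti Y (2 * d)⦄, a + b = 2 * d →
      IsOfHodgeType m Y (2 * d) a b y → IsOfHodgeType n X (2 * q) (a + e) (b + e)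
        (complexGysin μ hE hX φ hdq (complexBetti.map π (2 * d) y)) := by
    -- Hodge types: `π^*` preserves them, `φ_*` shifts them by `(e, e)`
    intro a b y hab hy
    obtain ⟨B⟩ := (nonempty_hodgeModel_holds (n := k) (X := E)).nonempty hE
    have hπy : IsOfHodgeType k E (2 * d) a b (complexBetti.map π (2 * d) y) :=
      hy.map_of_independent hI hE hY B π
    exact isOfHodgeType_complexGysin hI (fun m Y ↦ nonempty_hodgeModel_holds)
      (fun E _ _ _ ↦ Literature.NumberTheory.Transcendental.exists_deRhamIsoFamily_holds E) μ hE hX φ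
      hdq (p' := a + e) (q' := b + e) (by omega) (by omega) hπy
  by_cases hdk : 2 * d ≤ 2 * k
  · -- `φ_* (ι z) = v • ι (f_! z)` for rational orientations, `v ≠ 0`
    obtain ⟨νE⟩ := Motives.ComplexPoints.isOrientableOver ℚ hE
    obtain ⟨νX, hνX⟩ := exists_ratOrientation_hasPoincareDuality hX
    obtain ⟨v, hv, hcomp⟩ := complexGysin_ringChange_eq_smul_gysinMap hμ hE hX φ
      (show 2 * d + (2 * k - 2 * d) = 2 * k by omega)
      (show 2 * q + (2 * k - 2 * d) = 2 * n by omega) νE νX hνX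
    refine ⟨v⁻¹, inv_ne_zero hv, fun y hy ↦ ?_, htyp⟩
    -- rationality
    obtain ⟨y₀, rfl⟩ := hy.exists_ringChange_eq
    have hπ : complexBetti.map π (2 * d)
        (singularCohomology.ringChange (algebraMap ℚ ℂ) (ComplexPoints Y) (2 * d) y₀) =
        singularCohomology.ringChange (algebraMap ℚ ℂ) (ComplexPoints E) (2 * d)
          (singularCohomology.map ℚ ℚ (Motives.AlgPoints.mapContinuous (L := ℂ) π) (2 * d) y₀) :=
      (ringChange_map (Motives.AlgPoints.mapContinuous (L := ℂ) π) y₀).symm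
    rw [hπ, hcomp, smul_smul, inv_mul_cancel₀ hv, one_smul]
    exact isRationalClass_ringChange _
  · -- degrees `2d > 2 dim E`: `φ_* = 0`
    refine ⟨1, one_ne_zero, fun y _ ↦ ?_, htyp⟩
    rw [complexGysin_of_lt hE hX φ hdq (not_le.1 hdk), LinearMap.zero_apply, smul_zero]
    exact IsRationalClass.zero

end HodgeTheory

end Literature.AlgebraicGeometry.HodgeTheory

end
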